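import Mathlib
import HarnessLib

/-!
# Decay of the entries of the inverse of a band matrix (Demko–Moss–Smith 1984)

Literature anchor for S. Demko, W. F. Moss, P. W. Smith, *Decay rates for inverses of band
matrices*, Math. Comp. 43 (1984) 491–499 [DemkoMossSmith1984].

Verbatim (p. 492): "we will say that `A` is m-banded if there is an index `l` so that `A(i,j) = 0`
if `j ∉ [i − l, i − l + m]`. We will say that `A` is centered and m-banded if `m` is even and the
`l` above may be chosen to be `m/2`. Thus, for a centered m-banded matrix one has `A(i,j) = 0` if
`|i − j| > m/2`." PROPOSITION 2.1 (Chebyshev). "Let `f(x) = 1/x` and let `0 < a < b`. Set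
`r = b/a` and `q := q(r) := (√r − 1)/(√r + 1)` (2.1). Then
`e_n([a,b]) = (1 + √r)² /(2ar) · q^{n+1}` (2.2)." PROPOSITION 2.2. "Let `A` be a positive
definite, m-banded, bounded and boundedly invertible matrix in `l²(S)`. Let `[a, b]` be the
smallest interval containing `σ(A)`. Set `r = b/a`, `q = q(r)` as in (2.1), and set
`C₀ = (1 + r^{1/2})²/(2ar)` and `λ = q^{2/m}`. Then we have `|A^{−1}(i,j)| ≤ C λ^{|i−j|}` (2.3)
where `C = C(a,r) := max{a^{−1}, C₀}`." Proof (p. 493): "`A^k` is centered and km-banded for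
`k = 0, 1, 2, …`. Thus if `p ∈ Π_n` then `p(A)` is nm-banded and centered. From Proposition 2.1 we
know there exists a sequence of polynomials `p_n ∈ Π_n` satisfying
`‖1/x − p_n‖_{[a,b]} ≤ C₀ q^{n+1}`. An application of the spectral theory yields
`‖A^{−1} − p_n(A)‖ = ‖1/x − p_n‖_{σ(A)} ≤ C₀ q^{n+1}`. Now writing `|i − j| = nm/2 + k` for
`k = 1, …, m/2` and `i ≠ j`, we see that `|i − j| 2/m ≤ (n + 1)` and hence
`|A^{−1}(i,j)| = |A^{−1}(i,j) − p_n(A)(i,j)| ≤ ‖A^{−1} − p_n(A)‖ ≤ C₀ q^{n+1} ≤ C₀ λ^{|i−j|}`."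
PROPOSITION 2.3. "Let `A` be m-banded, bounded and boundedly invertible on `l²(S)`. Let `[a, b]`
be the smallest interval containing `σ(AA^*)`. Then setting `r = b/a`, `q = q(r)` as in (2.1),
and `λ₁ = q^{1/m}`, there is a constant `C₁` depending on `A` so that
`|A^{−1}(i,j)| ≤ C₁ λ₁^{|i−j|}` (2.4). … This result follows immediately from Proposition 2.2,
the observation that `A^{−1} = A^*(AA^*)^{−1}` and the fact that `‖A‖ = ‖A^*‖`."

## How it is typed

Finite matrices over `Fin N` (the case `S = {1, …, N}`), real entries. "Centered and banded with
half-bandwidth `s`" (`s = m/2`) is the HYPOTHESIS `∀ i j, s < |i − j| → A i j = 0` with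
`|i − j| = ((i : ℤ) − j).natAbs`; no definition is introduced. The analytic input of the proof
— Proposition 2.1 together with the spectral theorem, i.e. the existence for every `n` of a
polynomial `p_n` of degree `≤ n` with the ENTRYWISE bound `|(A^{−1} − p_n(A))(i,j)| ≤ C₀ q^{n+1}`
(which follows from the operator-norm bound) — enters as the hypothesis `happrox`; the matrix
`X` plays the role of `A^{−1}` (invertibility is not needed for the combinatorial mechanism).
What is proved here is the DMS mechanism: band structure of products and powers, of `p(A)`,
the index bookkeeping `n = ⌈|i−j|/s⌉ − 1`, and the assembled decay bound in the two forms
`C q^{⌈|i−j|/s⌉}` and `C λ^{|i−j|}` with `λ = q^{1/s} = q^{2/m}`; plus the facts about the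
Chebyshev rate `q(r)` and the identity `A^{−1} = Aᵀ(AAᵀ)^{−1}` behind Proposition 2.3.

## Theorems

* `banded_mul` — half-bandwidths add under products; `banded_transpose`; `banded_one`;
  `banded_pow` — "`A^k` is centered and km-banded"; `banded_polynomial` — "`p(A)` is nm-banded".
* `entry_eq_of_banded_approximant`, `abs_entry_le_of_banded_approximant` — the inequality
  `|A^{−1}(i,j)| = |A^{−1}(i,j) − p_n(A)(i,j)| ≤ …` outside the band of `p_n(A)`.
* `index_bookkeeping` — for `d ≥ 1`, `s ≥ 1` and `n = (d − 1)/s`: `n s < d ≤ (n + 1) s`.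
* `decay_of_polynomial_approximation` — Proposition 2.2 assembled:
  `|X(i,j)| ≤ C q^{(|i−j|−1)/s + 1}` for `i ≠ j`.
* `pow_le_rpow_of_index` and `decay_rate_form` — the form (2.3): `|X(i,j)| ≤ C λ^{|i−j|}`,
  `λ = q^{1/s}`.
* `chebyshevRate_nonneg`, `chebyshevRate_lt_one`, `chebyshevRate_eq_zero_iff`, `chebyshevC0_pos`
  — the constants of (2.1)–(2.2) for `r ≥ 1`, `a > 0`.
* `inv_eq_transpose_mul_inv` — "`A^{−1} = A^*(AA^*)^{−1}`" (real case), `banded_gram` —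
  `AAᵀ` has half-bandwidth `2s` — and `banded_transpose_mul_polynomial_gram` — the approximants
  `Aᵀ p(AAᵀ)`, `deg p ≤ n`, vanish for `|i−j| > (2n+1)s`: the reduction of Proposition 2.3 to
  Proposition 2.2 with rate `λ₁ = q^{1/m}`.
* `tridiagonal_inverse_fin_three` — the `3 × 3` second-difference matrix: its inverse
  `(1/4)[[3,2,1],[2,4,2],[1,2,3]]` decays away from the diagonal.

## Not typed

The spectral theorem step `‖A^{−1} − p(A)‖ = ‖1/x − p‖_{σ(A)}`, Chebyshev's theorem (2.2)
itself, the infinite cases `S = ℤ₊, ℤ`, Theorem 2.4 / (2.8)–(2.10) (the same bounds with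
`cond(A)`), §3 examples, §4 (essential spectrum, compact perturbations) and §5.

## Related anchors

`Literature.LinearAlgebra.Matrix.NullityTheorem` (rank structure of inverses of banded
matrices), `Literature.Analysis.Matrix.ChebyshevIteration`,
`Literature.Analysis.Matrix.ConjugateGradientConvergence` and
`Literature.Analysis.Approximation.ChebyshevShiftedMinimax` / `ChebyshevMinimaxOptimality`
(the same rate `(√κ − 1)/(√κ + 1)`, there for the residual-polynomial min–max problem).

## References

* [DemkoMossSmith1984] S. Demko, W. F. Moss, P. W. Smith, Decay rates for inverses of band
  matrices, Math. Comp. 43 (1984), no. 168, 491–499, doi:10.1090/S0025-5718-1984-0758197-9.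
-/

open Matrix Finset

namespace Literature.LinearAlgebra.Matrix.BandedInverseDecay

variable {N : ℕ} {R : Type*} [CommRing R]

/-! ### Band structure of products, powers and polynomials -/

/-- Half-bandwidths add under multiplication: if `A(i,j) = 0` for `|i−j| > s` and `B(i,j) = 0`
for `|i−j| > t` then `(AB)(i,j) = 0` for `|i−j| > s + t`.
[cite: DemkoMossSmith1984, §2 proof of Prop. 2.2 (p. 493)] -/
theorem banded_mul (A B : Matrix (Fin N) (Fin N) R) (s t : ℕ)
    (hA : ∀ i j : Fin N, s < ((i : ℤ) - j).natAbs → A i j = 0)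
    (hB : ∀ i j : Fin N, t < ((i : ℤ) - j).natAbs → B i j = 0) :
    ∀ i j : Fin N, s + t < ((i : ℤ) - j).natAbs → (A * B) i j = 0 := by
  intro i j hij
  rw [Matrix.mul_apply]
  refine Finset.sum_eq_zero fun k _ => ?_
  by_cases hik : s < ((i : ℤ) - k).natAbs
  · rw [hA i k hik, zero_mul]
  by_cases hkj : t < ((k : ℤ) - j).natAbs
  · rw [hB k j hkj, mul_zero]
  exfalso
  have h := Int.natAbs_add_le ((i : ℤ) - k) ((k : ℤ) - j)
  rw [show ((i : ℤ) - k) + ((k : ℤ) - j) = (i : ℤ) - j by ring] at h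
  omega

/-- Transposition preserves the half-bandwidth. [cite: DemkoMossSmith1984, §2 Prop. 2.3 (p. 493)] -/
theorem banded_transpose (A : Matrix (Fin N) (Fin N) R) (s : ℕ)
    (hA : ∀ i j : Fin N, s < ((i : ℤ) - j).natAbs → A i j = 0) :
    ∀ i j : Fin N, s < ((i : ℤ) - j).natAbs → Aᵀ i j = 0 := by
  intro i j hij
  rw [transpose_apply]
  apply hA
  rwa [← Int.natAbs_neg, neg_sub]

/-- The identity is centered `0`-banded (the case `k = 0` of "`A^k` is km-banded").
[cite: DemkoMossSmith1984, §2 proof of Prop. 2.2 (p. 493)] -/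
theorem banded_one :
    ∀ i j : Fin N, 0 < ((i : ℤ) - j).natAbs → (1 : Matrix (Fin N) (Fin N) R) i j = 0 := by
  intro i j hij
  apply one_apply_ne
  rintro rfl
  simp at hij

/-- "`A^k` is centered and km-banded for `k = 0, 1, 2, …`".
[cite: DemkoMossSmith1984, §2 proof of Prop. 2.2 (p. 493)] -/
theorem banded_pow (A : Matrix (Fin N) (Fin N) R) (s : ℕ)
    (hA : ∀ i j : Fin N, s < ((i : ℤ) - j).natAbs → A i j = 0) :
    ∀ k : ℕ, ∀ i j : Fin N, k * s < ((i : ℤ) - j).natAbs → (A ^ k) i j = 0 := by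
  intro k
  induction k with
  | zero =>
    intro i j hij
    rw [pow_zero]
    exact banded_one i j (by omega)
  | succ k ih =>
    intro i j hij
    rw [pow_succ]
    exact banded_mul (A ^ k) A (k * s) s ih hA i j (by rw [Nat.succ_mul] at hij; exact hij)

/-- "if `p ∈ Π_n` then `p(A)` is nm-banded and centered": a combination `∑_{k ≤ n} c_k A^k`
vanishes at `(i,j)` whenever `|i−j| > n s`.
[cite: DemkoMossSmith1984, §2 proof of Prop. 2.2 (p. 493)] -/
theorem banded_polynomial (A : Matrix (Fin N) (Fin N) R) (s : ℕ)
    (hA : ∀ i j : Fin N, s < ((i : ℤ) - j).natAbs → A i j = 0) (n : ℕ) (c : ℕ → R) :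
    ∀ i j : Fin N, n * s < ((i : ℤ) - j).natAbs →
      (∑ k ∈ range (n + 1), c k • A ^ k) i j = 0 := by
  intro i j hij
  rw [Matrix.sum_apply]
  refine Finset.sum_eq_zero fun k hk => ?_
  rw [Matrix.smul_apply, banded_pow A s hA k i j ?_, smul_zero]
  have hk' : k ≤ n := Nat.lt_succ_iff.mp (Finset.mem_range.mp hk)
  exact lt_of_le_of_lt (Nat.mul_le_mul_right s hk') hij

/-! ### The key inequality and the index bookkeeping -/

/-- Outside the band of the approximant, `A^{−1}(i,j) = A^{−1}(i,j) − p_n(A)(i,j)`.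
[cite: DemkoMossSmith1984, §2 proof of Prop. 2.2 (p. 493); §4 (p. 496)] -/
theorem entry_eq_of_banded_approximant (X P : Matrix (Fin N) (Fin N) R) (i j : Fin N)
    (hP : P i j = 0) : X i j = (X - P) i j := by
  rw [Matrix.sub_apply, hP, sub_zero]

/-- "`|A^{−1}(i,j)| = |A^{−1}(i,j) − p_n(A)(i,j)| ≤ ‖A^{−1} − p_n(A)‖ ≤ C₀ q^{n+1}`": an entrywise
bound on `X − P` is a bound on `X(i,j)` wherever `P(i,j) = 0`.
[cite: DemkoMossSmith1984, §2 proof of Prop. 2.2 (p. 493)] -/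
theorem abs_entry_le_of_banded_approximant (X P : Matrix (Fin N) (Fin N) ℝ) (i j : Fin N) (ε : ℝ)
    (hP : P i j = 0) (hε : |(X - P) i j| ≤ ε) : |X i j| ≤ ε := by
  rwa [entry_eq_of_banded_approximant X P i j hP]

/-- The bookkeeping "writing `|i − j| = nm/2 + k` for `k = 1, …, m/2` … `|i − j| 2/m ≤ n + 1`":
with half-bandwidth `s ≥ 1`, distance `d ≥ 1` and `n = (d − 1)/s` (integer division) one has
`n s < d` (so `p_n(A)(i,j) = 0`) and `d ≤ (n + 1) s` (so `q^{n+1} ≤ q^{d/s}`).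
[cite: DemkoMossSmith1984, §2 proof of Prop. 2.2 (p. 493)] -/
theorem index_bookkeeping (d s : ℕ) (hs : 0 < s) (hd : 0 < d) :
    (d - 1) / s * s < d ∧ d ≤ ((d - 1) / s + 1) * s := by
  constructor
  · exact lt_of_le_of_lt (Nat.div_mul_le_self (d - 1) s) (by omega)
  · have h := Nat.lt_div_mul_add (a := d - 1) hs
    rw [Nat.add_mul, one_mul]
    omega

/-! ### Proposition 2.2 assembled -/

/-- PROPOSITION 2.2, mechanism: if `A` has half-bandwidth `s ≥ 1` and for every `n` some
combination `p_n(A) = ∑_{k ≤ n} c_k A^k` approximates `X` (`= A^{−1}`) entrywise within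
`C q^{n+1}`, then off the diagonal `|X(i,j)| ≤ C q^{⌈|i−j|/s⌉} = C q^{(|i−j|−1)/s + 1}`.
[cite: DemkoMossSmith1984, §2 Prop. 2.2 (2.3) and its proof (pp. 492-493)] -/
theorem decay_of_polynomial_approximation (A X : Matrix (Fin N) (Fin N) ℝ) (s : ℕ) (hs : 0 < s)
    (hA : ∀ i j : Fin N, s < ((i : ℤ) - j).natAbs → A i j = 0) (C q : ℝ)
    (happrox : ∀ n : ℕ, ∃ c : ℕ → ℝ,
      ∀ i j : Fin N, |(X - ∑ k ∈ range (n + 1), c k • A ^ k) i j| ≤ C * q ^ (n + 1)) :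
    ∀ i j : Fin N, i ≠ j →
      |X i j| ≤ C * q ^ ((((i : ℤ) - j).natAbs - 1) / s + 1) := by
  intro i j hij
  set d := ((i : ℤ) - j).natAbs with hd
  have hd0 : 0 < d := by
    rw [hd, Int.natAbs_pos]
    exact sub_ne_zero.mpr (by exact_mod_cast (Fin.val_injective.ne hij))
  obtain ⟨c, hc⟩ := happrox ((d - 1) / s)
  refine abs_entry_le_of_banded_approximant X _ i j _ ?_ (hc i j)
  exact banded_polynomial A s hA ((d - 1) / s) c i j (index_bookkeeping d s hs hd0).1

/-- For `0 < q ≤ 1` and `d ≤ (n+1) s`: `q^{n+1} ≤ q^{d/s} = λ^d` with `λ = q^{1/s}`.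
[cite: DemkoMossSmith1984, §2 proof of Prop. 2.2 (p. 493)] -/
theorem pow_le_rpow_of_index (q : ℝ) (hq0 : 0 < q) (hq1 : q ≤ 1) (d s n : ℕ) (hs : 0 < s)
    (h : d ≤ (n + 1) * s) : q ^ (n + 1) ≤ q ^ ((d : ℝ) / s) := by
  rw [← Real.rpow_natCast]
  apply Real.rpow_le_rpow_of_exponent_ge hq0 hq1
  rw [div_le_iff₀ (by exact_mod_cast hs)]
  exact_mod_cast h

/-- PROPOSITION 2.2 in the form (2.3): `|A^{−1}(i,j)| ≤ C λ^{|i−j|}` with `λ = q^{2/m} = q^{1/s}`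
(written `q^{|i−j|/s}`), for `i ≠ j`, `C ≥ 0`, `0 < q ≤ 1`.
[cite: DemkoMossSmith1984, §2 Prop. 2.2 (2.3) (p. 492)] -/
theorem decay_rate_form (A X : Matrix (Fin N) (Fin N) ℝ) (s : ℕ) (hs : 0 < s)
    (hA : ∀ i j : Fin N, s < ((i : ℤ) - j).natAbs → A i j = 0) (C q : ℝ) (hC : 0 ≤ C)
    (hq0 : 0 < q) (hq1 : q ≤ 1)
    (happrox : ∀ n : ℕ, ∃ c : ℕ → ℝ,
      ∀ i j : Fin N, |(X - ∑ k ∈ range (n + 1), c k • A ^ k) i j| ≤ C * q ^ (n + 1)) :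
    ∀ i j : Fin N, i ≠ j → |X i j| ≤ C * q ^ ((((i : ℤ) - j).natAbs : ℝ) / s) := by
  intro i j hij
  have h1 := decay_of_polynomial_approximation A X s hs hA C q happrox i j hij
  refine le_trans h1 (mul_le_mul_of_nonneg_left ?_ hC)
  have hd0 : 0 < ((i : ℤ) - j).natAbs := by
    rw [Int.natAbs_pos]
    exact sub_ne_zero.mpr (by exact_mod_cast (Fin.val_injective.ne hij))
  exact pow_le_rpow_of_index q hq0 hq1 _ s _ hs
    (index_bookkeeping _ s hs hd0).2

/-! ### The constants of Proposition 2.1 -/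

/-- `q(r) = (√r − 1)/(√r + 1) ≥ 0` for `r = b/a ≥ 1`.
[cite: DemkoMossSmith1984, §2 (2.1) (p. 492)] -/
theorem chebyshevRate_nonneg (r : ℝ) (hr : 1 ≤ r) : 0 ≤ (Real.sqrt r - 1) / (Real.sqrt r + 1) := by
  have h1 : 1 ≤ Real.sqrt r := by rw [← Real.sqrt_one]; exact Real.sqrt_le_sqrt hr
  exact div_nonneg (by linarith) (by linarith)

/-- `q(r) < 1`. [cite: DemkoMossSmith1984, §2 (2.1) (p. 492)] -/
theorem chebyshevRate_lt_one (r : ℝ) : (Real.sqrt r - 1) / (Real.sqrt r + 1) < 1 := by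
  have h0 : 0 ≤ Real.sqrt r := Real.sqrt_nonneg r
  rw [div_lt_one (by linarith)]
  linarith

/-- `q(r) = 0` exactly when `r = 1` (`a = b`, i.e. `A` is a multiple of the identity).
[cite: DemkoMossSmith1984, §2 (2.1) (p. 492)] -/
theorem chebyshevRate_eq_zero_iff (r : ℝ) (hr : 0 ≤ r) :
    (Real.sqrt r - 1) / (Real.sqrt r + 1) = 0 ↔ r = 1 := by
  have h0 : 0 ≤ Real.sqrt r := Real.sqrt_nonneg r
  rw [div_eq_zero_iff, or_iff_left (by linarith), sub_eq_zero]
  constructor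
  · intro h
    have := Real.sq_sqrt hr
    rw [h] at this
    linarith
  · rintro rfl
    exact Real.sqrt_one

/-- `C₀ = (1 + √r)²/(2ar) > 0` for `a > 0`, `r > 0`.
[cite: DemkoMossSmith1984, §2 Prop. 2.2 (p. 492)] -/
theorem chebyshevC0_pos (a r : ℝ) (ha : 0 < a) (hr : 0 < r) :
    0 < (1 + Real.sqrt r) ^ 2 / (2 * a * r) := by
  have h0 : 0 ≤ Real.sqrt r := Real.sqrt_nonneg r
  positivity

/-! ### Proposition 2.3: reduction to the positive definite case -/

/-- "the observation that `A^{−1} = A^*(AA^*)^{−1}`" (real case, `A` invertible).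
[cite: DemkoMossSmith1984, §2 Prop. 2.3 (p. 493)] -/
theorem inv_eq_transpose_mul_inv (A : Matrix (Fin N) (Fin N) ℝ) (hA : IsUnit A.det) :
    A⁻¹ = Aᵀ * (A * Aᵀ)⁻¹ := by
  have hAT : IsUnit Aᵀ.det := by rwa [det_transpose]
  rw [Matrix.mul_inv_rev, ← Matrix.mul_assoc, Matrix.mul_nonsing_inv _ hAT, Matrix.one_mul]

/-- If `A` has half-bandwidth `s` then `AAᵀ` has half-bandwidth `2s`, so Proposition 2.2 applied
to `AAᵀ` and `banded_mul` for `Aᵀ · p(AAᵀ)` give the rate `λ₁ = q^{1/m}` of (2.4).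
[cite: DemkoMossSmith1984, §2 Prop. 2.3 (2.4) (p. 493)] -/
theorem banded_gram (A : Matrix (Fin N) (Fin N) R) (s : ℕ)
    (hA : ∀ i j : Fin N, s < ((i : ℤ) - j).natAbs → A i j = 0) :
    ∀ i j : Fin N, 2 * s < ((i : ℤ) - j).natAbs → (A * Aᵀ) i j = 0 := by
  intro i j hij
  exact banded_mul A Aᵀ s s hA (banded_transpose A s hA) i j (by omega)

/-- The approximants of Proposition 2.3: `Aᵀ p(AAᵀ)` with `deg p ≤ n` vanishes at `(i,j)` for
`|i−j| > (2n+1) s`. [cite: DemkoMossSmith1984, §2 Prop. 2.3 (p. 493)] -/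
theorem banded_transpose_mul_polynomial_gram (A : Matrix (Fin N) (Fin N) R) (s : ℕ)
    (hA : ∀ i j : Fin N, s < ((i : ℤ) - j).natAbs → A i j = 0) (n : ℕ) (c : ℕ → R) :
    ∀ i j : Fin N, (2 * n + 1) * s < ((i : ℤ) - j).natAbs →
      (Aᵀ * ∑ k ∈ range (n + 1), c k • (A * Aᵀ) ^ k) i j = 0 := by
  intro i j hij
  refine banded_mul Aᵀ _ s (n * (2 * s)) (banded_transpose A s hA)
    (banded_polynomial (A * Aᵀ) (2 * s) (banded_gram A s hA) n c) i j ?_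
  convert hij using 1
  ring

/-! ### A worked example -/

/-- The `3 × 3` second-difference matrix `T = [[2,−1,0],[−1,2,−1],[0,−1,2]]` (tridiagonal,
`s = 1`, `σ(T) ⊂ [2 − √2, 2 + √2]`) has `T^{−1} = (1/4)[[3,2,1],[2,4,2],[1,2,3]]`: the entries
decay away from the diagonal. [cite: DemkoMossSmith1984, §3 (p. 494)] -/
theorem tridiagonal_inverse_fin_three :
    (!![2, -1, 0; -1, 2, -1; 0, -1, 2] : Matrix (Fin 3) (Fin 3) ℚ)⁻¹ =
      !![3/4, 1/2, 1/4; 1/2, 1, 1/2; 1/4, 1/2, 3/4] := by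
  apply Matrix.inv_eq_right_inv
  ext i j
  fin_cases i <;> fin_cases j <;> simp [Matrix.mul_apply, Fin.sum_univ_three] <;> norm_num

end Literature.LinearAlgebra.Matrix.BandedInverseDecay
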